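import Mathlib
import HarnessLib
import Summits.Ventures.LatticeQCDFlow.Scoring.GlivenkoCantelli

/-!
# The empirical process at a MOVING point: `√n(F̂ₙ(tₙ) − F(tₙ)) ⇒ N(0, F(q)(1 − F(q)))` whenever
# `F(tₙ) → F(q)` — the central limit theorem for the empirical distribution function at a fixed
# point plus an increment that vanishes in probability (the step behind the sample-quantile CLT)

HONEST FRAMING: exact (Metropolis-corrected) sampling algorithms for lattice gauge theory;
figures of merit are autocorrelation/cost numbers at stated couplings and volumes; no
continuum-physics claim.

Venture `LatticeQCDFlow` (cell pub-lqcd), topic `Scoring`; FANOUT row 4 (`s0-u1-b`, rung S0-B).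
The printed card reports medians and percentiles; their error bars rest on the asymptotic
normality of sample quantiles, whose classical proof inverts the empirical distribution function
at the moving point `tₙ = q + x/√n`.  Mathlib's central limit theorem is for a FIXED iid
sequence, not for the triangular array `1{Xᵢ ≤ tₙ}`; this file sidesteps the array: at the fixed
point `q` the indicators `1{Xᵢ ≤ q}` are iid Bernoulli and Mathlib's CLT applies
(**`edf_clt_at`**, variance `F(q)(1 − F(q))`), while the increment
`Rₙ = (√n)⁻¹ Σ_{i<n} [(1{Xᵢ ≤ tₙ} − 1{Xᵢ ≤ q}) − (F(tₙ) − F(q))]` has mean zero and variance at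
most `|F(tₙ) − F(q)| → 0`, hence `Rₙ → 0` in probability by Chebyshev
(**`edf_increment_tendstoInMeasure`**); Slutsky gives **`edf_clt_moving`**.  NEW WORK of the
cell (classical; our formalisation); no definition; nothing cited as a fact.

## Content

* `integral_indicator_Iic_stream`, `sq_indicator_sub_indicator`, `integral_sq_increment`;
* **`edf_clt_at`** — `(√n)⁻¹(Σ_{i<n} 1{Xᵢ ≤ s} − nF(s)) ⇒ N(0, F(s)(1 − F(s)))`;
* **`edf_increment_tendstoInMeasure`** — the increment vanishes in probability;
* **`edf_clt_moving`** — `(√n)⁻¹(Σ_{i<n} 1{Xᵢ ≤ tₙ} − nF(tₙ)) ⇒ N(0, F(q)(1 − F(q)))`.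

NOT CLAIMED: the functional (Donsker) statement; dependent samples; the reweighted card.
-/

noncomputable section

namespace Summit.Ventures.LatticeQCDFlow.Scoring.GlivenkoCantelli

open MeasureTheory ProbabilityTheory Finset Filter Function
open scoped Topology

variable {Ω : Type*} [MeasurableSpace Ω] {P : Measure Ω} [IsProbabilityMeasure P]
variable {Ω' : Type*} [MeasurableSpace Ω'] {P' : Measure Ω'} [IsProbabilityMeasure P']
variable {X : ℕ → Ω → ℝ}

/-! ## §1 Bernoulli bookkeeping -/

section Bernoulli

/-- `E 1{Xᵢ ≤ s} = F(s)`, `F = cdf (P ∘ X₀⁻¹)`, along an identically distributed stream.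
[folklore] -/
theorem integral_indicator_Iic_stream (hXm : ∀ i, Measurable (X i))
    (hid : ∀ i, IdentDistrib (X i) (X 0) P P) (i : ℕ) (s : ℝ) :
    ∫ ω, (Set.Iic s).indicator (1 : ℝ → ℝ) (X i ω) ∂P = cdf (P.map (X 0)) s := by
  haveI : IsProbabilityMeasure (P.map (X 0)) :=
    Measure.isProbabilityMeasure_map (hXm 0).aemeasurable
  have hgm : Measurable ((Set.Iic s).indicator (1 : ℝ → ℝ)) :=
    measurable_one.indicator measurableSet_Iic
  rw [← integral_map (hXm i).aemeasurable hgm.aestronglyMeasurable, (hid i).map_eq, cdf_eq_real]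
  exact integral_indicator_one measurableSet_Iic

/-- `(1{x ≤ t} − 1{x ≤ q})² = 1{x ≤ t} + 1{x ≤ q} − 2·1{x ≤ min t q}`. [folklore] -/
theorem sq_indicator_sub_indicator (t q x : ℝ) :
    ((Set.Iic t).indicator (1 : ℝ → ℝ) x - (Set.Iic q).indicator (1 : ℝ → ℝ) x) ^ 2
      = (Set.Iic t).indicator (1 : ℝ → ℝ) x + (Set.Iic q).indicator (1 : ℝ → ℝ) x
        - 2 * (Set.Iic (min t q)).indicator (1 : ℝ → ℝ) x := by
  by_cases ht : x ≤ t <;> by_cases hq : x ≤ q <;>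
    norm_num [Set.indicator_of_mem, Set.indicator_of_notMem, Set.mem_Iic, ht, hq]

/-- `E (1{Xᵢ ≤ t} − 1{Xᵢ ≤ q})² = |F(t) − F(q)|`. [ours] -/
theorem integral_sq_increment (hXm : ∀ i, Measurable (X i))
    (hid : ∀ i, IdentDistrib (X i) (X 0) P P) (i : ℕ) (t q : ℝ) :
    ∫ ω, ((Set.Iic t).indicator (1 : ℝ → ℝ) (X i ω) - (Set.Iic q).indicator (1 : ℝ → ℝ) (X i ω)) ^ 2 ∂P
      = |cdf (P.map (X 0)) t - cdf (P.map (X 0)) q| := by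
  haveI : IsProbabilityMeasure (P.map (X 0)) :=
    Measure.isProbabilityMeasure_map (hXm 0).aemeasurable
  have hint : ∀ s : ℝ, Integrable (fun ω => (Set.Iic s).indicator (1 : ℝ → ℝ) (X i ω)) P :=
    fun s => Integrable.of_bound
      (((measurable_one.indicator measurableSet_Iic).comp (hXm i)).aestronglyMeasurable) 1
      (ae_of_all _ fun ω => by
        rw [Real.norm_eq_abs, abs_of_nonneg (indicator_one_nonneg _ _)]
        exact indicator_one_le_one _ _)
  simp_rw [sq_indicator_sub_indicator]
  rw [integral_sub (f := fun ω => (Set.Iic t).indicator (1 : ℝ → ℝ) (X i ω)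
      + (Set.Iic q).indicator (1 : ℝ → ℝ) (X i ω)) ((hint t).add (hint q)) ((hint _).const_mul 2),
    integral_add (hint t) (hint q), integral_const_mul, integral_indicator_Iic_stream hXm hid,
    integral_indicator_Iic_stream hXm hid, integral_indicator_Iic_stream hXm hid]
  rcases le_total t q with h | h
  · rw [min_eq_left h, abs_of_nonpos (sub_nonpos.2 (monotone_cdf _ h))]
    ring
  · rw [min_eq_right h, abs_of_nonneg (sub_nonneg.2 (monotone_cdf _ h))]
    ring

end Bernoulli

/-! ## §2 The CLT at a fixed point -/

section Fixed

/-- **THE EMPIRICAL DISTRIBUTION FUNCTION AT A FIXED POINT IS ASYMPTOTICALLY NORMAL**: iid real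
`Xᵢ`, `F = cdf (P ∘ X₀⁻¹)`, `W ∼ N(0, F(s)(1 − F(s)))` ⇒
`(√n)⁻¹(Σ_{i<n} 1{Xᵢ ≤ s} − n·F(s)) ⇒ W` (`= √n(F̂ₙ(s) − F(s))` for `n ≥ 1`). [ours] (Mathlib's
CLT for the Bernoulli indicators) -/
theorem edf_clt_at (hXm : ∀ i, Measurable (X i)) (hind : iIndepFun X P)
    (hid : ∀ i, IdentDistrib (X i) (X 0) P P) (s : ℝ) {W : Ω' → ℝ}
    (hW : HasLaw W (gaussianReal 0
      (cdf (P.map (X 0)) s * (1 - cdf (P.map (X 0)) s)).toNNReal) P') :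
    TendstoInDistribution (fun (n : ℕ) ω => (Real.sqrt n)⁻¹
        * (∑ k ∈ range n, (Set.Iic s).indicator (1 : ℝ → ℝ) (X k ω) - n * cdf (P.map (X 0)) s))
      atTop W (fun _ => P) P' := by
  have hgm : Measurable ((Set.Iic s).indicator (1 : ℝ → ℝ)) :=
    measurable_one.indicator measurableSet_Iic
  have hmem : MemLp (fun ω => (Set.Iic s).indicator (1 : ℝ → ℝ) (X 0 ω)) 2 P :=
    memLp_of_bounded (a := 0) (b := 1)
      (ae_of_all _ fun ω => ⟨indicator_one_nonneg _ _, indicator_one_le_one _ _⟩)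
      ((hgm.comp (hXm 0)).aestronglyMeasurable) 2
  have hindY : iIndepFun (fun k ω => (Set.Iic s).indicator (1 : ℝ → ℝ) (X k ω)) P :=
    hind.comp (fun _ x => (Set.Iic s).indicator (1 : ℝ → ℝ) x) fun _ => hgm
  have hidY : ∀ i, IdentDistrib (fun ω => (Set.Iic s).indicator (1 : ℝ → ℝ) (X i ω))
      (fun ω => (Set.Iic s).indicator (1 : ℝ → ℝ) (X 0 ω)) P P := fun i => (hid i).comp hgm
  have hmean : P[fun ω => (Set.Iic s).indicator (1 : ℝ → ℝ) (X 0 ω)] = cdf (P.map (X 0)) s :=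
    integral_indicator_Iic_stream hXm hid 0 s
  have hsq : (fun ω => (Set.Iic s).indicator (1 : ℝ → ℝ) (X 0 ω)) ^ 2
      = fun ω => (Set.Iic s).indicator (1 : ℝ → ℝ) (X 0 ω) := by
    funext ω
    simp only [Pi.pow_apply]
    by_cases h : X 0 ω ∈ Set.Iic s
    · simp [Set.indicator_of_mem h]
    · simp [Set.indicator_of_notMem h]
  have hvar : Var[fun ω => (Set.Iic s).indicator (1 : ℝ → ℝ) (X 0 ω); P]
      = cdf (P.map (X 0)) s * (1 - cdf (P.map (X 0)) s) := by
    rw [variance_eq_sub hmem, hsq, hmean]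
    ring
  have hW' : HasLaw W (gaussianReal 0
      (Var[fun ω => (Set.Iic s).indicator (1 : ℝ → ℝ) (X 0 ω); P]).toNNReal) P' := by
    rw [hvar]
    exact hW
  have hclt := tendstoInDistribution_inv_sqrt_mul_sum_sub
    (X := fun k ω => (Set.Iic s).indicator (1 : ℝ → ℝ) (X k ω)) (P := P) (P' := P') (Y := W)
    hW' hmem hindY hidY
  rw [hmean] at hclt
  exact hclt

end Fixed

/-! ## §3 The increment vanishes in probability -/

section Increment

/-- **THE INCREMENT OF THE EMPIRICAL PROCESS BETWEEN `q` AND `tₙ` VANISHES** when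
`F(tₙ) → F(q)`: `Rₙ = (√n)⁻¹ Σ_{i<n} [(1{Xᵢ ≤ tₙ} − 1{Xᵢ ≤ q}) − (F(tₙ) − F(q))] → 0` in
probability. [ours] (mean zero; variance `≤ E(1{X ≤ tₙ} − 1{X ≤ q})² = |F(tₙ) − F(q)|`;
Chebyshev) -/
theorem edf_increment_tendstoInMeasure (hXm : ∀ i, Measurable (X i)) (hind : iIndepFun X P)
    (hid : ∀ i, IdentDistrib (X i) (X 0) P P) {q : ℝ} {t : ℕ → ℝ}
    (ht : Tendsto (fun n => cdf (P.map (X 0)) (t n)) atTop (𝓝 (cdf (P.map (X 0)) q))) :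
    TendstoInMeasure P (fun (n : ℕ) ω => (Real.sqrt n)⁻¹ * ∑ k ∈ range n,
        (((Set.Iic (t n)).indicator (1 : ℝ → ℝ) (X k ω) - (Set.Iic q).indicator (1 : ℝ → ℝ) (X k ω))
          - (cdf (P.map (X 0)) (t n) - cdf (P.map (X 0)) q))) atTop fun _ => (0 : ℝ) := by
  set F : ℝ → ℝ := fun s => cdf (P.map (X 0)) s with hF
  -- the increment variables `D n k`
  set D : ℕ → ℕ → Ω → ℝ := fun n k ω =>
    (Set.Iic (t n)).indicator (1 : ℝ → ℝ) (X k ω) - (Set.Iic q).indicator (1 : ℝ → ℝ) (X k ω)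
    with hD
  have hgm : ∀ n, Measurable fun x : ℝ =>
      (Set.Iic (t n)).indicator (1 : ℝ → ℝ) x - (Set.Iic q).indicator (1 : ℝ → ℝ) x := fun n =>
    (measurable_one.indicator measurableSet_Iic).sub (measurable_one.indicator measurableSet_Iic)
  have hDm : ∀ n k, Measurable (D n k) := fun n k => (hgm n).comp (hXm k)
  have hDb : ∀ n k ω, D n k ω ∈ Set.Icc (-1 : ℝ) 1 := fun n k ω => by
    simp only [hD]
    constructor
    · linarith [indicator_one_nonneg (Set.Iic (t n)) (X k ω),
        indicator_one_le_one (Set.Iic q) (X k ω)]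
    · linarith [indicator_one_le_one (Set.Iic (t n)) (X k ω),
        indicator_one_nonneg (Set.Iic q) (X k ω)]
  have hDmem : ∀ n k, MemLp (D n k) 2 P := fun n k =>
    memLp_of_bounded (ae_of_all _ (hDb n k)) (hDm n k).aestronglyMeasurable 2
  have hDid : ∀ n k, IdentDistrib (D n k) (D n 0) P P := fun n k => (hid k).comp (hgm n)
  have hIint : ∀ k (s : ℝ), Integrable (fun ω => (Set.Iic s).indicator (1 : ℝ → ℝ) (X k ω)) P :=
    fun k s => Integrable.of_bound
      (((measurable_one.indicator measurableSet_Iic).comp (hXm k)).aestronglyMeasurable) 1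
      (ae_of_all _ fun ω => by
        rw [Real.norm_eq_abs, abs_of_nonneg (indicator_one_nonneg _ _)]
        exact indicator_one_le_one _ _)
  have hDmean : ∀ n k, ∫ ω, D n k ω ∂P = F (t n) - F q := fun n k => by
    simp only [hD]
    rw [integral_sub (hIint k _) (hIint k _), integral_indicator_Iic_stream hXm hid,
      integral_indicator_Iic_stream hXm hid]
  -- the uncentred scaled sum `S n = (√n)⁻¹ Σ_k D n k` : mean, variance
  have hSint : ∀ n : ℕ, Integrable (fun ω => (Real.sqrt n)⁻¹ * ∑ k ∈ range n, D n k ω) P :=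
    fun n => (integrable_finsetSum _ fun k _ => (hDmem n k).integrable one_le_two).const_mul _
  have hSmean : ∀ n : ℕ, ∫ ω, (Real.sqrt n)⁻¹ * ∑ k ∈ range n, D n k ω ∂P
      = (Real.sqrt n)⁻¹ * (n * (F (t n) - F q)) := fun n => by
    rw [integral_const_mul, integral_finsetSum _ fun k _ => (hDmem n k).integrable one_le_two]
    congr 1
    rw [Finset.sum_congr rfl fun k _ => hDmean n k, Finset.sum_const, Finset.card_range,
      nsmul_eq_mul]
  have hSmem : ∀ n : ℕ, MemLp (fun ω => (Real.sqrt n)⁻¹ * ∑ k ∈ range n, D n k ω) 2 P :=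
    fun n => (memLp_finsetSum _ fun k _ => hDmem n k).const_mul _
  have hSvar : ∀ n : ℕ, variance (fun ω => (Real.sqrt n)⁻¹ * ∑ k ∈ range n, D n k ω) P
      ≤ |F (t n) - F q| := fun n => by
    rw [variance_const_mul]
    have hvs : variance (fun ω => ∑ k ∈ range n, D n k ω) P = ∑ k ∈ range n, variance (D n k) P := by
      have h := IndepFun.variance_sum (μ := P) (s := range n) (X := D n)
        (fun k _ => hDmem n k)
        (fun i _ j _ hij => (hind.indepFun hij).comp (hgm n) (hgm n))
      rw [← h]
      congr 1
      funext ω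
      simp
    have hvk : ∀ k, variance (D n k) P ≤ |F (t n) - F q| := fun k => by
      rw [(hDid n k).variance_eq]
      refine (variance_le_expectation_sq (hDm n 0).aestronglyMeasurable).trans (le_of_eq ?_)
      have e : (D n 0) ^ 2 = fun ω => (D n 0 ω) ^ 2 := rfl
      rw [e]
      simp only [hD]
      exact integral_sq_increment hXm hid 0 (t n) q
    rw [hvs]
    calc (Real.sqrt n)⁻¹ ^ 2 * ∑ k ∈ range n, variance (D n k) P
        ≤ (Real.sqrt n)⁻¹ ^ 2 * ∑ _k ∈ range n, |F (t n) - F q| :=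
          mul_le_mul_of_nonneg_left (Finset.sum_le_sum fun k _ => hvk k) (sq_nonneg _)
      _ = ((Real.sqrt n)⁻¹ ^ 2 * n) * |F (t n) - F q| := by
          rw [Finset.sum_const, Finset.card_range, nsmul_eq_mul]
          ring
      _ ≤ 1 * |F (t n) - F q| := by
          refine mul_le_mul_of_nonneg_right ?_ (abs_nonneg _)
          rw [inv_pow, Real.sq_sqrt (Nat.cast_nonneg n)]
          rcases Nat.eq_zero_or_pos n with h0 | hpos
          · simp [h0]
          · have hn : (0 : ℝ) < n := by exact_mod_cast hpos
            rw [inv_mul_cancel₀ hn.ne']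
      _ = |F (t n) - F q| := one_mul _
  -- Chebyshev
  rw [tendstoInMeasure_iff_norm]
  intro ε hε
  have hδ : Tendsto (fun n => |F (t n) - F q|) atTop (𝓝 0) := by
    have h := (ht.sub_const (F q)).abs
    simp only [hF, sub_self, abs_zero] at h ⊢
    exact h
  have hbound : Tendsto (fun n => ENNReal.ofReal (|F (t n) - F q| / ε ^ 2)) atTop (𝓝 0) := by
    have h := (hδ.div_const (ε ^ 2))
    rw [zero_div] at h
    have h' := ENNReal.tendsto_ofReal h
    rwa [ENNReal.ofReal_zero] at h'
  refine tendsto_of_tendsto_of_tendsto_of_le_of_le' tendsto_const_nhds hbound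
    (Eventually.of_forall fun n => zero_le) (Eventually.of_forall fun n => ?_)
  -- the centred increment is `S n − E S n`
  have hcheb := meas_ge_le_variance_div_sq (hSmem n) hε
  rw [hSmean n] at hcheb
  refine le_trans (measure_mono fun ω hω => ?_)
    (hcheb.trans (ENNReal.ofReal_le_ofReal (div_le_div_of_nonneg_right (hSvar n) (sq_nonneg _))))
  simp only [Set.mem_setOf_eq, sub_zero, Real.norm_eq_abs] at hω ⊢
  have e : (Real.sqrt n)⁻¹ * ∑ k ∈ range n, (D n k ω - (F (t n) - F q))
      = (Real.sqrt n)⁻¹ * ∑ k ∈ range n, D n k ω - (Real.sqrt n)⁻¹ * (n * (F (t n) - F q)) := by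
    rw [Finset.sum_sub_distrib, Finset.sum_const, Finset.card_range, nsmul_eq_mul, mul_sub]
  simp only [hD] at e ⊢
  rw [← e]
  exact hω

end Increment

/-! ## §4 The empirical process at a moving point -/

section Moving

/-- **THE EMPIRICAL PROCESS AT A MOVING POINT**: iid real `Xᵢ`, `F = cdf (P ∘ X₀⁻¹)`, a
deterministic sequence `tₙ` with `F(tₙ) → F(q)`, `W ∼ N(0, F(q)(1 − F(q)))` ⇒
`(√n)⁻¹(Σ_{i<n} 1{Xᵢ ≤ tₙ} − n·F(tₙ)) ⇒ W`. [ours] (fixed-point CLT + vanishing increment,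
Slutsky) -/
theorem edf_clt_moving (hXm : ∀ i, Measurable (X i)) (hind : iIndepFun X P)
    (hid : ∀ i, IdentDistrib (X i) (X 0) P P) {q : ℝ} {t : ℕ → ℝ}
    (ht : Tendsto (fun n => cdf (P.map (X 0)) (t n)) atTop (𝓝 (cdf (P.map (X 0)) q)))
    {W : Ω' → ℝ}
    (hW : HasLaw W (gaussianReal 0
      (cdf (P.map (X 0)) q * (1 - cdf (P.map (X 0)) q)).toNNReal) P') :
    TendstoInDistribution (fun (n : ℕ) ω => (Real.sqrt n)⁻¹
        * (∑ k ∈ range n, (Set.Iic (t n)).indicator (1 : ℝ → ℝ) (X k ω)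
          - n * cdf (P.map (X 0)) (t n)))
      atTop W (fun _ => P) P' := by
  have hclt := edf_clt_at hXm hind hid q hW
  have hR := edf_increment_tendstoInMeasure hXm hind hid ht
  have hRm : ∀ n : ℕ, AEMeasurable (fun ω => (Real.sqrt n)⁻¹ * ∑ k ∈ range n,
      (((Set.Iic (t n)).indicator (1 : ℝ → ℝ) (X k ω) - (Set.Iic q).indicator (1 : ℝ → ℝ) (X k ω))
        - (cdf (P.map (X 0)) (t n) - cdf (P.map (X 0)) q))) P := fun n =>
    ((Finset.measurable_sum _ fun k _ =>
      ((((measurable_one.indicator measurableSet_Iic).comp (hXm k)).sub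
        ((measurable_one.indicator measurableSet_Iic).comp (hXm k))).sub_const _)).const_mul _
      ).aemeasurable
  have hsum := hclt.add_of_tendstoInMeasure_const hR hRm
  refine hsum.congr (fun n => Eventually.of_forall fun ω => ?_)
    (Eventually.of_forall fun ω' => by simp)
  simp only [Pi.add_apply]
  rw [Finset.sum_sub_distrib, Finset.sum_sub_distrib, Finset.sum_const, Finset.card_range,
    nsmul_eq_mul]
  ring

end Moving

end Summit.Ventures.LatticeQCDFlow.Scoring.GlivenkoCantelli

end
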